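import Summits.BirchSwinnertonDyer.BirchSwinnertonDyer.Theorems.GoldfeldAllTwistsTwoConverseTwinBirchLemmaFormula
import Summits.BirchSwinnertonDyer.Rank1Residual.X12.O11.RouteUMemberE20
import Summits.BirchSwinnertonDyer.Rank1Residual.X12.O11.RouteUMemberE52
import Summits.BirchSwinnertonDyer.Rank1Residual.X12.O11.RouteUMemberE68
import Summits.BirchSwinnertonDyer.Rank1Residual.X11b.AnticyclotomicEmbedding
import Summits.BirchSwinnertonDyer.Rank1Residual.X11b.RouteR1LogOmega
import Mathlib.Tactic.NormNum.LegendreSymbol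
import HarnessLib

set_option linter.dupNamespace false -- namespace `…BirchSwinnertonDyer.BirchSwinnertonDyer…` is the cell's (D-0017 nested layout)
set_option autoImplicit false

/-!
# LINE B49, file 4 — clause (i) of the even-discriminant Birch lemma for `X₀(49)` («Conjecture D(q)» in
# Heegner form) IS IN PRINT on the `7`-adic-unit sub-family: Kriz–Li 2019, Thm. 1.20 at the ADDITIVE
# Eisenstein prime `p = 7`, for `E = X₀(49)` over `K = ℚ(√−q)`

Cell `bsd-goldfeld`, seat `bsd-goldfeld-s1p-c301` (prover, gen 5), TARGET v5.1 §2 c301 (e) / planner g12 memo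
`LINE-B49-PRESEARCH.md` §3–§4 (evidence on items 19140, 20044). `--supports` the S1⁺ route items
stmt-BirchSwinnertonDyer-20044 (K12₂″ `…Theses.GoldfeldAllTwistsTwoConverse.RankOneTwoConverseCMSevenAdditiveTwo`, RANK axis)
and 19140 (twin″ `…BSDTwoCMSevenAdditiveRankOne`): it DISCHARGES clause (i) of seat c301 gen 4's
`@[conjecture] X049BirchLemmaEvenDiscr` (file 1 of the line, `…TwinBirchLemma`) on an explicit decidable infinite
sub-family, from a REFEREED theorem already typed in the tree. HONEST FRAMING: `p = 7`, RANK axis only — nothing here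
is about `p = 2`, clause (ii) of B49 (the `2`-part of the Heegner index = twin″ on the family), the ∀-statement K12₂″, or
the non-unit `q`; BSD is not proved by any of this; both items stay OPEN; a closed item would close a rung leaf only.

## The mathematics (Kriz–Li, Forum Math. Sigma 7 (2019) e15, Thm. 1.20 = Thm. 7.1, Rem. 1.21; tree fact
## `KrizLi2019.thm120_padicLogHeegner_unit_of_bernoulli`, `Literature/…/KrizLi2019/EisensteinHeegnerLog.lean`)

`E = X₀(49) = cm7 = [1,−1,0,−2,−1]` (globally minimal, `N = 49`, CM by `ℤ[(1+√−7)/2]`), `p = 7`: `E[7]` is reducible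
with `E[7]^{ss} ≅ 𝔽₇(ω²) ⊕ 𝔽₇(ω⁵)` — in the fact's trace form `a_ℓ(E) ≡ ℓ² + ℓ⁵ (mod 7)`, bsd-cm's PROVED (E49)
`RouteU.lFunction_cm7_mod_seven` — so `ψ = ω²` (primitive, conductor `f = 7`, EVEN, hence `ψ₀ = ψ`). Hypotheses:
(1) `ψ(7) = 0 ≠ 1`, `(ψ⁻¹ω)(7) = ω⁻¹(7) = 0 ≠ 1`; (2) CM ⇒ no multiplicative prime; (3) vacuous (`E` is good at
every `ℓ ≠ 7`); `p = 7` is ADDITIVE for `E` — allowed ("does not require `p ∤ N`", FMS p. 42; Rem. 1.21 names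
exactly the case of CM by `ℚ(√−p)`). `K = ℚ(√−q)`, `q` prime with `(q/7) = −1`, `d_K = −4q`: the Heegner
hypothesis for `49` ⟺ `7` splits in `K` ⟺ `(−q/7) = +1` (c301's B49 hypothesis, `jacobiSym_neg_prime_seven`); the
embedding `K ↪ K_𝔭 = ℚ₇` at a degree-one prime `𝔭 ∣ 7` (`X11b.embAt`); `ε_K` = the Kronecker character mod `4q`
(values `[a odd]·(−q/a)`, bsd-cm `RouteU.exists_kroneckerFour` / `isKroneckerCharacterOf_kroneckerFour`). The
Bernoulli pair is `B_{1,ψ₀⁻¹ε_K} · B_{1,ψ₀ω⁻¹} = B_{1,ε_Kω⁴} · B_{1,ω}`; `B_{1,ω}` is a `7`-unit for every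
Teichmüller `ω` (`RouteU.norm_bernoulliOnePrim_teichmuller_seven`), so the hypothesis is the SINGLE decidable
condition **`7 ∤ B_{1,ε_{−4q}ω⁴}`** — by planner g12's census `482` of the `572` such `q < 20000` (first members
`5, 13, 17, 41, 61, 73, 89, 101`; first exceptions `97, 157, 409, 509`). Conclusion of Thm. 1.20:
`(|Ẽ^{ns}(𝔽₇)|/7)·log_{ω_E} P ≢ 0 (mod 7)`, hence `log_{ω_𝓔} P ≠ 0` (`KrizLi2019.padicLogOmega_ne_zero_of_not_norm_le`),
hence `P ∉ E(K)_tors` (the formal logarithm kills exactly the torsion: `X11b.R1.logOmega_eq_zero_iff`, whose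
`logOmega` is `Castella2018.padicLogOmega` by `rfl`).

## Contents (THEOREMS ONLY; no `def`, no instance, no named fact; every published input a cite-tagged binder BY NAME)

* §0 the characters for `ψ = ω²`: `teichmuller_sq_even`, `teichmuller_sq_isPrimitive`, `teichmuller_sq_inv_eq_pow_four`
  (`(ω²)⁻¹ = ω⁴`), `invMulOmega_teichmuller_sq` (`ψ⁻¹ω = ω⁻¹↑`), hypotheses (1a)/(1b), and the `hss` binder
  `hss_cm7_teichmuller_sq` (from (E49) via `RouteU.hss_of_traceForm`, `ε_ℓ = 1`).
* §1 the Bernoulli pair: `bernoulliCharOne_teichmuller_sq` (`ψ₀⁻¹ε = ε↑·(ω⁴)↑` = bsd-cm's `θ₁`),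
  `bernoulliCharTwo_teichmuller_sq` (`ψ₀ω⁻¹ = ω↑`), `norm_bernoulliOnePrim_bernoulliCharTwo_teichmuller_sq` (`= 1`
  always), `bernoulli_hypothesis_cm7_of_cert` (the fact's binder `hB` from ONE certificate in bsd-cm's `hcert₁` shape
  `‖B_{1,θ}‖₇ = 1 ∀ θ mod 7·4q with values [j odd]·(−q/j)·ω(j)⁴`).
* §2 **T1** `not_isOfFinAddOrder_heegnerPoint_cm7_of_thm120`: KL19 Thm. 1.20 ∧ certificate(q) ⟹ every level-`49`
  Heegner point `P ∈ X₀(49)(K)` (`IsHeegnerPoint 49 cm7 K P`, any datum, any Manin constant) has infinite order, for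
  every imaginary quadratic `K` with `d_K = −4q`, `q` prime, `(q/7) = −1` — i.e. clause (i) of `X049BirchLemmaEvenDiscr`
  and the CONCLUSION of seat c201's sub-leaf `X049HeegnerNonTorsionEvenDiscr` at these `K`, with no Selmer hypothesis.
* §3 **T3** the certified members `q = 5, 13, 17` (`d_K = −20, −52, −68`), UNCONDITIONAL in the certificate:
  bsd-cm's kernel theorems `RouteU.norm_generalizedBernoulli_theta1_E20 / _E52 / _E68` (`decide +kernel` sums of
  length `28q`) ARE the certificate verbatim. Further `q` (`41, 61, 73, 89, …`): one such certificate each.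
The `ℚ`-level consumers (T2 «D(q)»: `ord_{s=1} L(W,s) = 1` for every model `W` of `49a1^{(−q)}`; K12₂″'s conclusion
and the structure of the family; T4 twin″ ⟺ `ord₂ 𝔮₄₉ = 0` with no `r_an` hypothesis) are file 4b
`…TwinBirchLemmaKrizLi7Twists`.

PRESEARCH (planner g12, `LINE-B49-PRESEARCH.md` §2, corpus + galaxy): this use of Thm. 1.20 — for `X₀(49)` ITSELF over
`ℚ(√−q)`, `d_K` even — is written nowhere we hold ([corpus:paper:doi-10-1017-fms-2019-9 §1.6 Rem. 1.21] names the
CM-by-`ℚ(√−p)` specialisation but draws no twist-family corollary; bsd-cm's ROUTE U applies the theorem to the TWISTS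
`49a1^{(D)}` over auxiliary fields for BSD₇, never to `r_an` of a twist; [galaxy: none]); a new combination of
refereed results, no new mathematics claimed. Statement-design note: the prime `q` enters through `[Fact q.Prime]`
(bsd-cm's instances `NeZero (7·(4·q))` for the certificate's level); callers holding `hq : q.Prime` use `Fact.mk hq`.

References: D. Kriz, C. Li, Forum Math. Sigma 7 (2019) e15, Thm. 1.20, Rem. 1.17, Rem. 1.21, §1.5, §2, Thm. 7.1
[KrizLi2019]; L. Washington, *Cyclotomic Fields*, §5.1, Thm. 4.2 [Washington1997]; B. Mazur, Invent. Math. 44 (1978)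
Prop. 6.3 [Mazur1978]; J. Silverman, AEC, IV.6.4, VII.6.3 [SilvermanAEC2009]; A. Fröhlich, M. Taylor, *Algebraic
Number Theory*, III (1.14) [FrohlichTaylor1990]; D. Cox, *Primes of the form x² + ny²*, Lemma 1.14 [Cox2013];
B. Gross, in *L-functions and Arithmetic* (1991) (1.1) [Gross1991].
-/

noncomputable section

open scoped Classical NumberTheorySymbols

open WeierstrassCurve NumberField DirichletCharacter
open Literature.NumberTheory Literature.NumberTheory.EllipticCurves
  Literature.NumberTheory.EllipticCurves.ModularForms
open Literature.NumberTheory.EllipticCurves.KrizLi2019 Literature.NumberTheory.LFunctions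
open Summit.BirchSwinnertonDyer.Rank1Residual
open Summit.BirchSwinnertonDyer.Rank1Residual.X12.O11.RouteU

namespace Summit.BirchSwinnertonDyer.BirchSwinnertonDyer.Theorems.GoldfeldGoodTwists

/-! ## §0 The characters of Thm. 1.20 for `E = X₀(49)` at `p = 7`: `ψ = ω²` (conductor `7`) -/

section Characters

variable (ω : DirichletCharacter ℚ_[7] 7)

/-- `ψ = ω²` is EVEN: `ω(−1)² = ω((−1)²) = 1`; so `ψ₀ = ψ` in Thm. 1.20. [cite: KrizLi2019, §1.5 (p. 7, ψ₀)] -/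
theorem teichmuller_sq_even : (ω ^ 2).Even := by
  rw [DirichletCharacter.Even, MulChar.pow_apply' _ two_ne_zero, sq, ← map_mul, neg_mul_neg, one_mul, map_one]

/-- `ψ = ω²` is primitive of conductor `7` (`ω² ≠ 1`, prime level). [cite: Washington1997, §5.1 and Ch. 3] -/
theorem teichmuller_sq_isPrimitive (hω : IsTeichmullerCharacter ω) : (ω ^ 2).IsPrimitive :=
  (isPrimitive_def _).mpr (conductor_eq_of_prime_of_ne_one (ω ^ 2) (teichmuller_sq_ne_one ω hω))

/-- `(ω²)⁻¹ = ω⁴` for a character modulo `7` with `ω(a)⁶ = 1` at the units (values at `0` are `0` on both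
sides). [cite: Washington1997, §5.1 (ω has order p − 1)] -/
theorem teichmuller_sq_inv_eq_pow_four : (ω ^ 2)⁻¹ = ω ^ 4 := by
  refine MulChar.ext' fun a => ?_
  rw [MulChar.inv_apply_eq_inv', MulChar.pow_apply' _ two_ne_zero, MulChar.pow_apply' _ (by norm_num)]
  by_cases ha : (7 : ℤ) ∣ (a.val : ℤ)
  · have h0 : a = 0 := by
      have : ((a.val : ℕ) : ZMod 7) = 0 := (ZMod.natCast_eq_zero_iff _ _).mpr (by exact_mod_cast ha)
      rwa [ZMod.natCast_zmod_val] at this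
    rw [h0, MulChar.map_zero, zero_pow two_ne_zero, zero_pow (by norm_num), inv_zero]
  · have h6 : ω a ^ 6 = 1 := by
      have := apply_pow_sub_one_eq_one ω (a.val : ℤ) ha
      rwa [Int.cast_natCast, ZMod.natCast_zmod_val] at this
    apply inv_eq_of_mul_eq_one_right
    rw [← pow_add]
    exact h6

/-- The character `ψ⁻¹ω` of hypotheses (1)/(3) for `ψ = ω²` is the lift of `ω⁻¹` to level `49`.
[cite: KrizLi2019, Thm. 1.20 (1) (p. 7)] -/
theorem invMulOmega_teichmuller_sq : invMulOmega (ω ^ 2) ω = changeLevel (dvd_mul_left 7 7) ω⁻¹ := by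
  unfold invMulOmega
  rw [← map_mul, sq, mul_inv_rev, mul_assoc, inv_mul_cancel, mul_one]

/-- **Hypothesis (1b) of Thm. 1.20 for `X₀(49)` at `p = 7`: `(ψ⁻¹ω)(7) ≠ 1`** — the primitive character is
`ω⁻¹` of conductor `7`, whose value at `7` is `0`. [cite: KrizLi2019, Thm. 1.20 (1) (p. 7)] -/
theorem primVal_invMulOmega_teichmuller_sq_seven_ne_one (hω : IsTeichmullerCharacter ω) :
    primVal (invMulOmega (ω ^ 2) ω) 7 ≠ 1 := by
  apply primVal_ne_one_of_not_coprime
  rw [invMulOmega_teichmuller_sq, conductor_changeLevel, conductor_inv,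
    conductor_eq_of_prime_of_ne_one ω (ne_one_of_isTeichmullerCharacter (by norm_num) hω)]
  decide

/-- **Hypothesis (1a): `ψ(7) = ω(7)² = 0 ≠ 1`.** [cite: KrizLi2019, Thm. 1.20 (1) (p. 7)] -/
theorem teichmuller_sq_apply_seven_ne_one : (ω ^ 2) ((7 : ℕ) : ZMod 7) ≠ 1 :=
  apply_natCast_ne_one_of_not_coprime _ 7 (by decide)

/-- **The `hss` binder of Thm. 1.20 for `W = X₀(49) = cm7`, `ψ = ω²`**: `a_ℓ(49a1) ≡ ℓ² + ℓ⁵ ≡ ψ(ℓ) + ψ⁻¹(ℓ)ω(ℓ)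
(mod 7)` for every prime `ℓ ∤ 7·49` — the trace form (E49) `RouteU.lFunction_cm7_mod_seven` (Gross's
`E[𝔭] ≅ μ₇^{⊗5}`, `ρ̄^{ss} = ω² ⊕ ω⁵`) read through `RouteU.hss_of_traceForm` with `ε_ℓ = 1`.
[cite: KrizLi2019, Thm. 1.20 and §2 (trace form of E[p]^{ss})] [cite: Mazur1978, Prop. 6.3 (1) (p. 153)] -/
theorem hss_cm7_teichmuller_sq (hω : IsTeichmullerCharacter ω) :
    ∀ ℓ : ℕ, ℓ.Prime → ¬ (ℓ ∣ 7 * cm7.conductorNorm ℤ) →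
      ‖((cm7.LFunction ℓ : ℤ) : ℚ_[7]) -
        ((ω ^ 2) (ℓ : ZMod 7) + (ω ^ 2)⁻¹ (ℓ : ZMod 7) * ω (ℓ : ZMod 7))‖ < 1 := by
  refine hss_of_traceForm cm7 (ω ^ 2) ω hω (fun _ => 1) (fun ℓ hℓ hℓN => ?_) (fun ℓ hℓ hℓN => ?_)
  · have h7 : ℓ ≠ 7 := by
      rintro rfl
      exact hℓN (dvd_mul_right 7 _)
    haveI := Fact.mk hℓ
    rw [lFunction_cm7_mod_seven ℓ h7, Int.cast_one, one_mul]
  · rw [MulChar.pow_apply' _ two_ne_zero, teichmuller_sq_inv_eq_pow_four, MulChar.pow_apply' _ (by norm_num),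
      Int.cast_one, one_mul]
    ring

/-! ## §1 The Bernoulli pair of Thm. 1.20 for `ψ = ω²`: `B_{1,ε_Kω⁴} · B_{1,ω}` -/

/-- **`ψ₀⁻¹ε_K = ε_K↑·(ω⁴)↑`** at level `7·d` for `ψ = ω²` (even, so `ψ₀ = ψ`) and any `ε` mod `d`: it is
bsd-cm's `θ₁`-character (`RouteU.thetaOneK_apply`). [cite: KrizLi2019, Thm. 1.20 (p. 8, the Bernoulli hypothesis)] -/
theorem bernoulliCharOne_teichmuller_sq {d : ℕ} (ε : DirichletCharacter ℚ_[7] d) :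
    bernoulliCharOne (ω ^ 2) ε =
      changeLevel (dvd_mul_left d 7) ε * changeLevel (dvd_mul_right 7 d) (ω ^ 4) := by
  unfold bernoulliCharOne evenTwist
  rw [if_pos (teichmuller_sq_even ω), ← map_inv, teichmuller_sq_inv_eq_pow_four]
  exact mul_comm _ _

/-- **`ψ₀ω⁻¹ = ω↑`** at level `7·d·7` for `ψ = ω²`. [cite: KrizLi2019, Thm. 1.20 (p. 8, the Bernoulli hypothesis)] -/
theorem bernoulliCharTwo_teichmuller_sq {d : ℕ} (ε : DirichletCharacter ℚ_[7] d) :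
    bernoulliCharTwo (ω ^ 2) ε ω = changeLevel (dvd_mul_left 7 (7 * d)) ω := by
  unfold bernoulliCharTwo evenTwist
  rw [if_pos (teichmuller_sq_even ω), ← changeLevel_trans, ← map_mul, sq, mul_inv_cancel_right]

/-- **The second Bernoulli factor is a `7`-unit for every `K`: `‖B_{1,ψ₀ω⁻¹}‖₇ = ‖B_{1,ω}‖₇ = 1`**
(`RouteU.norm_bernoulliOnePrim_teichmuller_seven`: `Σ_{j<7} j⁸ = 7·306085`). [cite: Washington1997, §5.1 and Thm. 4.2] -/
theorem norm_bernoulliOnePrim_bernoulliCharTwo_teichmuller_sq (hω : IsTeichmullerCharacter ω) {d : ℕ} [NeZero d]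
    (ε : DirichletCharacter ℚ_[7] d) : ‖bernoulliOnePrim (bernoulliCharTwo (ω ^ 2) ε ω)‖ = 1 := by
  rw [bernoulliCharTwo_teichmuller_sq, bernoulliOnePrim_changeLevel]
  exact norm_bernoulliOnePrim_teichmuller_seven ω hω

/-- **The Bernoulli hypothesis of Thm. 1.20 for `(X₀(49), 7, ℚ(√−q))` from ONE certificate.** For `q` prime,
`q ≡ 1 (mod 4)`, `q ≠ 7`, `χ` the Kronecker character mod `4q` of `ℚ(√−q)` (values `[a odd]·(−q/a)`) and `ε_K`
its lift to any level `D` with `4q ∣ D`: if `‖B_{1,θ}‖₇ = 1` for every character `θ` mod `7·4q` with values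
`[j odd]·(−q/j)·ω(j)⁴` (bsd-cm's `hcert₁` shape, e.g. `RouteU.norm_generalizedBernoulli_theta1_E20`), then
`B_{1,ψ₀⁻¹ε_K} · B_{1,ψ₀ω⁻¹} ≢ 0 (mod 7)` for `ψ = ω²`. [cite: KrizLi2019, Thm. 1.20 (p. 8, the Bernoulli hypothesis)]
[cite: Washington1997, §5.1 and Thm. 4.2] -/
theorem bernoulli_hypothesis_cm7_of_cert (hω : IsTeichmullerCharacter ω) {q : ℕ} [Fact q.Prime]
    (hq7 : q ≠ 7) (hq4 : q % 4 = 1) (χ : DirichletCharacter ℚ_[7] (4 * q))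
    (hχ : ∀ a : ℕ, χ (a : ZMod (4 * q)) = ((if Even a then (0 : ℤ) else J(-(q : ℤ) | a) : ℤ) : ℚ_[7]))
    (hcert : ∀ θ : DirichletCharacter ℚ_[7] (7 * (4 * q)),
      (∀ j : ZMod (7 * (4 * q)), θ j =
        ((if Even j.val then (0 : ℤ) else J(-(q : ℤ) | j.val) : ℤ) : ℚ_[7]) * ω (j.val : ZMod 7) ^ 4) →
      ‖generalizedBernoulli 1 θ‖ = 1)
    {D : ℕ} [NeZero D] (hdiv : 4 * q ∣ D) :
    ¬ (‖bernoulliOnePrim (bernoulliCharOne (ω ^ 2) (changeLevel hdiv χ)) *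
        bernoulliOnePrim (bernoulliCharTwo (ω ^ 2) (changeLevel hdiv χ) ω)‖ ≤ (7 : ℝ)⁻¹) := by
  have hq : q.Prime := Fact.out
  have hχodd : ∀ a : ℕ, Odd a → χ (a : ZMod (4 * q)) = (J(-(q : ℤ) | a) : ℚ_[7]) := fun a ha => by
    rw [hχ a, if_neg (Nat.not_even_iff_odd.mpr ha)]
  have hχp : χ.IsPrimitive := isPrimitive_kroneckerFour (m := -(q : ℤ)) (by simp) (by omega)
    (by rw [← Int.squarefree_natAbs]; simpa using hq.squarefree) hχodd
  have h47 : (4 * q).Coprime 7 := by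
    rw [Nat.coprime_comm, Nat.Prime.coprime_iff_not_dvd (by norm_num)]
    intro hd
    rcases (Nat.Prime.dvd_mul (by norm_num)).mp hd with h | h
    · revert h; decide
    · exact hq7 ((Nat.prime_dvd_prime_iff_eq (by norm_num) hq).mp h).symm
  have hu₁ : ‖bernoulliOnePrim (bernoulliCharOne (ω ^ 2) (changeLevel hdiv χ))‖ = 1 := by
    have hprim : (changeLevel (dvd_mul_left (4 * q) 7) χ * changeLevel (dvd_mul_right 7 (4 * q)) (ω ^ 4) :
        DirichletCharacter ℚ_[7] (7 * (4 * q))).IsPrimitive := by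
      rw [thetaOneK_eq_psiK_inv ω χ _ hχ kroneckerVal_trichotomy]
      exact psiJ_inv_isPrimitive ω χ h47 hω hχp
    rw [bernoulliCharOne_changeLevel, bernoulliOnePrim_changeLevel, bernoulliCharOne_teichmuller_sq,
      bernoulliOnePrim_eq_of_isPrimitive _ hprim]
    exact hcert _ (thetaOneK_apply ω χ _ hχ)
  exact not_norm_mul_le_inv_of_norm_eq_one hu₁
    (norm_bernoulliOnePrim_bernoulliCharTwo_teichmuller_sq ω hω (changeLevel hdiv χ))

end Characters

/-! ## §2 T1 — the level-`49` Heegner point over `ℚ(√−q)` has infinite order (KL19 Thm. 1.20 at `p = 7`) -/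

/-- **T1. Clause (i) of `X049BirchLemmaEvenDiscr` («Conjecture D(q)» in Heegner form) on the `7`-adic-unit
sub-family, from Kriz–Li 2019 Thm. 1.20 at the additive Eisenstein prime `p = 7`.** Let `q` be a prime with
`(q/7) = −1`, `K` an imaginary quadratic field with `d_K = −4q` (so `q ≡ 1 (mod 4)`, `7` splits in `K`, `2`
ramifies), and assume the Bernoulli-unit certificate `hcert`: `‖B_{1,θ}‖₇ = 1` for every Teichmüller `ω` mod `7`
and every character `θ` mod `7·4q` with values `[j odd]·(−q/j)·ω(j)⁴` — i.e. `7 ∤ B_{1,ε_{−4q}ω⁴}` (decidable per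
`q`; bsd-cm's kernel certificates `RouteU.norm_generalizedBernoulli_theta1_E20/_E52/_E68` are the cases
`q = 5, 13, 17`). Then, granted `KrizLi2019.thm120_padicLogHeegner_unit_of_bernoulli` (named fact, refereed), EVERY
level-`49` Heegner point `P ∈ X₀(49)(K)` has infinite order. Instantiation: `E = cm7 = 49a1` (globally minimal,
`N = 49`), `p = 7` (additive for `E` — allowed, FMS p. 42 / Rem. 1.21), `ψ = ω²` (primitive, conductor `7`;
`E[7]^{ss} = 𝔽₇(ω²) ⊕ 𝔽₇(ω⁵)` in trace form, §0), (1) `ψ(7) = 0 ≠ 1`, `(ψ⁻¹ω)(7) = 0 ≠ 1`, (2) CM ⇒ no multiplicative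
prime, (3) vacuous (`49a1` is good away from `7`), Heegner hypothesis for `49` ⟸ `(−q/7) = 1`, `7` split ⇒ a
degree-one prime `𝔭 ∣ 7` and the embedding `K ↪ K_𝔭 = ℚ₇` (`X11b.embAt`), `ε_K` = the lift of the Kronecker
character mod `4q` (`RouteU.exists_kroneckerFour`, `isKroneckerCharacterOf_kroneckerFour`), Bernoulli pair
`B_{1,ε_Kω⁴}·B_{1,ω}` (§1); conclusion `(7/7)·log_{ω_E} P ≢ 0 (mod 7)` ⇒ `log_{ω_𝓔} P ≠ 0` ⇒ `P ∉ E(K)_tors`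
(`X11b.R1.logOmega_eq_zero_iff`). RANK axis, `p = 7` only: nothing here concerns `p = 2` or clause (ii) of B49.
[cite: KrizLi2019, Thm. 1.20 (pp. 7–8) = Thm. 7.1, Rem. 1.21 (p. 8)] [cite: Washington1997, §5.1]
[cite: SilvermanAEC2009, IV.6.4 and VII.6.3 (formal logarithm kills exactly the torsion)] -/
theorem not_isOfFinAddOrder_heegnerPoint_cm7_of_thm120
    (h120 : thm120_padicLogHeegner_unit_of_bernoulli) {q : ℕ} [Fact q.Prime] (hq7 : jacobiSym q 7 = -1)
    (hcert : ∀ (ω : DirichletCharacter ℚ_[7] 7), IsTeichmullerCharacter ω →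
      ∀ θ : DirichletCharacter ℚ_[7] (7 * (4 * q)),
        (∀ j : ZMod (7 * (4 * q)), θ j =
          ((if Even j.val then (0 : ℤ) else J(-(q : ℤ) | j.val) : ℤ) : ℚ_[7]) * ω (j.val : ZMod 7) ^ 4) →
        ‖generalizedBernoulli 1 θ‖ = 1)
    (K : Type) [Field K] [NumberField K] (hK : IsImaginaryQuadratic K)
    (hdK : NumberField.discr K = -(4 * (q : ℤ)))
    {P : (cm7.baseChange K).toAffine.Point} (hP : IsHeegnerPoint 49 cm7 K P) : ¬ IsOfFinAddOrder P := by
  have hq : q.Prime := Fact.out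
  haveI : Fact (Nat.Prime 7) := ⟨by norm_num⟩
  haveI : NeZero (cm7.conductorNorm ℤ) := ⟨(cm7.conductorNorm_pos_holds).ne'⟩
  have hq0 : 0 < q := hq.pos
  haveI : NeZero (NumberField.discr K).natAbs :=
    ⟨Int.natAbs_ne_zero.mpr (by rw [hdK]; omega)⟩
  have hq4 : q % 4 = 1 := prime_emod_four_eq_one_of_discr_eq hq hq7 K hK.1 hdK
  have hq7' : q ≠ 7 := by
    rintro rfl
    exact absurd hq7 (by norm_num)
  -- the Heegner hypothesis for `49`, `7` split in `K`, the embedding `K ↪ ℚ₇`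
  have hH : SatisfiesHeegnerHypothesis 49 K :=
    satisfiesHeegnerHypothesis_fortyNine_of_discr_eq K hK.1 (by rw [hdK]; ring) (jacobiSym_neg_prime_seven hq7)
  have hH' : SatisfiesHeegnerHypothesis (cm7.conductorNorm ℤ) K := by rw [conductorNorm_cm7]; exact hH
  have h7K : ((Ideal.span {((7 : ℕ) : ℤ)}).primesOver (𝓞 K)).ncard = 2 := hH 7 (by norm_num) (by norm_num)
  obtain ⟨𝔭, h𝔭, he, hf⟩ := X11b.exists_degreeOnePrime_of_splitsIn K 7 hK.1 h7K
  -- the datum at level `N(X₀(49))`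
  obtain ⟨D, H, ι, hPH⟩ := isHeegnerPoint_of_level_eq conductorNorm_cm7.symm hP
  -- the characters `ω`, `ε_K`
  obtain ⟨ω, hω⟩ := exists_isTeichmullerCharacter (p := 7)
  obtain ⟨χ, hχ⟩ := exists_kroneckerFour (-(q : ℤ)) (by omega) (k := 4 * q) (by simp)
  have hχodd : ∀ a : ℕ, Odd a → χ (a : ZMod (4 * q)) = (J(-(q : ℤ) | a) : ℚ_[7]) := fun a ha => by
    rw [hχ a, if_neg (Nat.not_even_iff_odd.mpr ha)]
  have hχp : χ.IsPrimitive := isPrimitive_kroneckerFour (m := -(q : ℤ)) (by simp) (by omega)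
    (by rw [← Int.squarefree_natAbs]; simpa using hq.squarefree) hχodd
  have hnat : (NumberField.discr K).natAbs = 4 * q := by
    rw [hdK, Int.natAbs_neg]
    norm_cast
  have hdiv : 4 * q ∣ (NumberField.discr K).natAbs := by rw [hnat]
  have hεK : IsKroneckerCharacterOf K (changeLevel hdiv χ) :=
    isKroneckerCharacterOf_kroneckerFour hK.1 (m := -(q : ℤ)) (by rw [hdK]; ring) χ hχp hχodd (by simp) hdiv
  -- Thm. 1.20
  have key := h120 7 (by norm_num) cm7 7 (ω ^ 2) ω (teichmuller_sq_isPrimitive ω hω) hω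
    (hss_cm7_teichmuller_sq ω hω) (teichmuller_sq_apply_seven_ne_one ω)
    (primVal_invMulOmega_teichmuller_sq_seven_ne_one ω hω)
    (not_hasSplitMultiplicativeReductionAtPrime_of_hasCM cm7 hasCM_cm7')
    (fun ℓ hℓ h7 hbad => by
      haveI := Fact.mk hℓ
      exact absurd (hasGoodReductionAtPrime_cm7 ℓ h7) hbad.1)
    D K hK hH' h7K (changeLevel hdiv χ) hεK H ι (X11b.embAt K 7 𝔭 h𝔭 he hf) P hPH
    (bernoulli_hypothesis_cm7_of_cert ω hω hq7' hq4 χ hχ (hcert ω hω) hdiv)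
  have hlog := padicLogOmega_ne_zero_of_not_norm_le key
  exact fun hfin => hlog ((X11b.R1.logOmega_eq_zero_iff cm7 7 (X11b.embAt K 7 𝔭 h𝔭 he hf) P).mpr hfin)

/-! ## §3 T3 over `K` — the three certified members `q = 5, 13, 17`: UNCONDITIONAL in the certificate -/

/-- **T3 (`q = 5`): every level-`49` Heegner point of `X₀(49)` over `K = ℚ(√−5)` (`d_K = −20`) has infinite
order**, granted KL19 Thm. 1.20 — the Bernoulli certificate `7 ∥ Σ_{j<140} χ_{−20}(j) j²⁹` is bsd-cm's kernel
theorem `RouteU.norm_generalizedBernoulli_theta1_E20`. [cite: KrizLi2019, Thm. 1.20 (pp. 7–8) and Rem. 1.21]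
[cite: Washington1997, §5.1 and Thm. 4.2] -/
theorem not_isOfFinAddOrder_heegnerPoint_cm7_discr_neg20 (h120 : thm120_padicLogHeegner_unit_of_bernoulli)
    (K : Type) [Field K] [NumberField K] (hK : IsImaginaryQuadratic K) (hdK : NumberField.discr K = -20)
    {P : (cm7.baseChange K).toAffine.Point} (hP : IsHeegnerPoint 49 cm7 K P) : ¬ IsOfFinAddOrder P :=
  haveI : Fact (Nat.Prime 5) := ⟨by norm_num⟩
  not_isOfFinAddOrder_heegnerPoint_cm7_of_thm120 h120 (q := 5) (by norm_num)
    norm_generalizedBernoulli_theta1_E20 K hK (by rw [hdK]; norm_num) hP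

/-- **T3 (`q = 13`): every level-`49` Heegner point of `X₀(49)` over `K = ℚ(√−13)` (`d_K = −52`) has infinite
order**, granted KL19 Thm. 1.20 (certificate `RouteU.norm_generalizedBernoulli_theta1_E52`).
[cite: KrizLi2019, Thm. 1.20 (pp. 7–8) and Rem. 1.21] [cite: Washington1997, §5.1 and Thm. 4.2] -/
theorem not_isOfFinAddOrder_heegnerPoint_cm7_discr_neg52 (h120 : thm120_padicLogHeegner_unit_of_bernoulli)
    (K : Type) [Field K] [NumberField K] (hK : IsImaginaryQuadratic K) (hdK : NumberField.discr K = -52)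
    {P : (cm7.baseChange K).toAffine.Point} (hP : IsHeegnerPoint 49 cm7 K P) : ¬ IsOfFinAddOrder P :=
  haveI : Fact (Nat.Prime 13) := ⟨by norm_num⟩
  not_isOfFinAddOrder_heegnerPoint_cm7_of_thm120 h120 (q := 13) (by norm_num)
    norm_generalizedBernoulli_theta1_E52 K hK (by rw [hdK]; norm_num) hP

/-- **T3 (`q = 17`): every level-`49` Heegner point of `X₀(49)` over `K = ℚ(√−17)` (`d_K = −68`) has infinite
order**, granted KL19 Thm. 1.20 (certificate `RouteU.norm_generalizedBernoulli_theta1_E68`).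
[cite: KrizLi2019, Thm. 1.20 (pp. 7–8) and Rem. 1.21] [cite: Washington1997, §5.1 and Thm. 4.2] -/
theorem not_isOfFinAddOrder_heegnerPoint_cm7_discr_neg68 (h120 : thm120_padicLogHeegner_unit_of_bernoulli)
    (K : Type) [Field K] [NumberField K] (hK : IsImaginaryQuadratic K) (hdK : NumberField.discr K = -68)
    {P : (cm7.baseChange K).toAffine.Point} (hP : IsHeegnerPoint 49 cm7 K P) : ¬ IsOfFinAddOrder P :=
  haveI : Fact (Nat.Prime 17) := ⟨by norm_num⟩
  not_isOfFinAddOrder_heegnerPoint_cm7_of_thm120 h120 (q := 17) (by norm_num)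
    norm_generalizedBernoulli_theta1_E68 K hK (by rw [hdK]; norm_num) hP

end Summit.BirchSwinnertonDyer.BirchSwinnertonDyer.Theorems.GoldfeldGoodTwists

end
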